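import Literature.Analysis.FluidPDE.OseenBoundedFieldsL3
import Literature.Analysis.FluidPDE.OseenKernelTimeContinuity
import HarnessLib

/-!
# Time continuity in `L³` of the Oseen Duhamel term of bounded fields

Analysis/FluidPDE support file (everything proved, no definitions) for the discharge of the
named fact `kato_local_bounded` (`KatoContinuation.lean`): the solution of Oseen's `L^∞` scheme
`w = e^{νtΔ}a - B^ν_0(w, w)` (Lemarié-Rieusset 2016, §9.9, Thm. 9.12) is a *Kato* solution only
if it is a curve in `C([0,T); L³)`, and the free term being one (`continuousInLpOn_heatFlow`,
`HeatFlowLpClass.lean`), what is needed is the time continuity in `L³` of the Duhamel term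
`B^ν_s(u,v)(t) = oseenDuhamel ν s u v t` of bounded fields:

* `oseenDuhamel_indicator_Iio`, `oseenDuhamel_eq_indicator_add` — **splitting at an intermediate
  time**: for `s ≤ t ≤ t'`, `B^ν_s(u,v)(t') = B^ν_s(1_{<t}u, 1_{<t}v)(t') + B^ν_t(u,v)(t')`
  pointwise (additivity of the outer time integral, the marginal being integrable for bounded
  measurable fields, `integrable_oseenKernel_duhamel_bounded`);
* `integral_inner_oseenDuhamel_increment_eq` — against a continuous compactly supported `φ` the
  increment `B^ν_s(1_{<t}u,1_{<t}v)(t') - B^ν_s(u,v)(t)` is the space–time integral over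
  `(s,t) × E` of the tested kernel increment `(K(ν(t'-τ)) - K(ν(t-τ)))(x-y)[u,v]` (the two
  Fubini identities `integral_inner_oseenDuhamel_eq_setIntegral`);
* `eLpNorm_oseenDuhamel_increment_le` — hence, by the tested estimate with the orthonormal-basis
  majorant of the kernel increment (`norm_oseenKernel_sub_le_sum_basis`) and `L³` duality,
  `‖B^ν_s(1_{<t}u,1_{<t}v)(t') - B^ν_s(u,v)(t)‖_{L³} ≤ M N ∫_{(s,t)}∫ ∑ᵢⱼ ‖K(ν(t'-τ))[eᵢ,eⱼ] -
  K(ν(t-τ))[eᵢ,eⱼ]‖`;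
* `continuousInLpOn_oseenDuhamel_three` — **`t ↦ B^ν_s(u,v)(t)` lies in `C([s,T]; L³)`**
  (`Fluid.ContinuousInLpOn (Icc s T) 3`) for `u`, `v` bounded measurable on `(s,T) × E` with
  `‖v(τ)‖_{L³} ≤ N`: the late piece has `‖B^ν_t(u,v)(t')‖₃ ≤ C M N ν^{-1/2}√(t'-t)`
  (`exists_eLpNorm_oseenDuhamel_three_le`), the increment piece is at most `M N Ω_{T-s}(t'-t)`
  with `Ω_S(h) → 0` as `h → 0⁺` (`tendsto_lintegral_sum_norm_oseenKernel_sub`,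
  `OseenKernelTimeContinuity.lean`) — a modulus of continuity uniform in `t`, whence two-sided
  continuity (Lemarié-Rieusset 2016, proof of Thm. 7.5, PDF pp. 157–158, continuity of `B(F,G)`
  at `t > 0` via `W_{ν(t-s)} - W_{ν(θ-s)}`; here with one factor in `L^∞`).

## References

* P. G. Lemarié-Rieusset, *The Navier–Stokes Problem in the 21st Century*, CRC Press 2016,
  doi:10.1201/b19556: proof of Thm. 7.5 (PDF pp. 157–158); §9.9 and proof of Thm. 9.12 (p. 260).
  [LemarieRieusset2016]
* H. Koch, D. Tataru, Adv. Math. 157 (2001), §2 (8), §3 (11), (14). [KochTataruAdvMath2001]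
-/

noncomputable section

open MeasureTheory TopologicalSpace Set Function Filter Metric InnerProductSpace
open _root_.Topology
open scoped ENNReal NNReal RealInnerProductSpace

namespace Literature.Analysis.FluidPDE

variable {E : Type*} [NormedAddCommGroup E] [InnerProductSpace ℝ E] [FiniteDimensional ℝ E]
  [MeasurableSpace E] [BorelSpace E]

/-! ### Splitting the Duhamel term at an intermediate time -/

section Split

variable {ν s T M : ℝ} {u v : ℝ → E → E}

omit [InnerProductSpace ℝ E] [MeasurableSpace E] [BorelSpace E] [FiniteDimensional ℝ E] in
/-- The time truncation of a field: `(Iio t).indicator u τ y = u τ y` for `τ < t` and `0` else.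
[folklore] -/
theorem indicator_Iio_apply_of_lt {t τ : ℝ} (h : τ < t) (u : ℝ → E → E) (y : E) :
    (Iio t).indicator u τ y = u τ y := by
  rw [indicator_of_mem (show τ ∈ Iio t from h)]

omit [InnerProductSpace ℝ E] [MeasurableSpace E] [BorelSpace E] [FiniteDimensional ℝ E] in
/-- The time truncation vanishes from `t` on. [folklore] -/
theorem indicator_Iio_apply_of_le {t τ : ℝ} (h : t ≤ τ) (u : ℝ → E → E) (y : E) :
    (Iio t).indicator u τ y = 0 := by
  rw [indicator_of_notMem (show τ ∉ Iio t from not_lt.2 h)]; rfl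

/-- **The time-truncated fields give the early part of the Duhamel integral**: for `t ≤ t'`,
`B^ν_s(1_{<t}u, 1_{<t}v)(t')(x) = ∫_{(s,t)} ∫ K(ν(t'-τ), x-y)[u(τ,y), v(τ,y)] dy dτ` (the
integrand vanishes for `τ ≥ t`; no integrability is needed). [folklore] -/
theorem oseenDuhamel_indicator_Iio {t t' : ℝ} (htt' : t ≤ t') (x : E) :
    oseenDuhamel ν s ((Iio t).indicator u) ((Iio t).indicator v) t' x =
      ∫ τ in Ioo s t, ∫ y, oseenKernel (ν * (t' - τ)) (x - y) (u τ y) (v τ y) := by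
  rw [oseenDuhamel_apply, setIntegral_eq_of_subset_of_forall_sdiff_eq_zero measurableSet_Ioo
    (Ioo_subset_Ioo_right htt') (fun τ hτ => ?_)]
  · refine setIntegral_congr_fun measurableSet_Ioo fun τ hτ => ?_
    simp only [indicator_Iio_apply_of_lt hτ.2]
  · have hτt : t ≤ τ := by
      by_contra h
      exact hτ.2 ⟨hτ.1.1, not_le.1 h⟩
    simp only [indicator_Iio_apply_of_le hτt, oseenKernel_zero_left, integral_zero]

/-- **Splitting the Duhamel term at an intermediate time**: for bounded measurable fields on
`(s, T) × E`, `ν > 0` and `s ≤ t ≤ t' ≤ T`, `s < t'`,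
`B^ν_s(u,v)(t') = B^ν_s(1_{<t}u, 1_{<t}v)(t') + B^ν_t(u,v)(t')` pointwise (additivity of the outer
time integral; the integrand `τ ↦ ∫ K(ν(t'-τ), x-y)[u,v] dy` is integrable on `(s, t')` as the
marginal of the absolutely convergent space–time integral). [folklore] -/
theorem oseenDuhamel_eq_indicator_add (hν : 0 < ν)
    (hu : AEStronglyMeasurable (uncurry u) ((volume : Measure (ℝ × E)).restrict (Ioo s T ×ˢ univ)))
    (hv : AEStronglyMeasurable (uncurry v) ((volume : Measure (ℝ × E)).restrict (Ioo s T ×ˢ univ)))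
    (hM : 0 ≤ M) (huM : ∀ τ ∈ Ioo s T, ∀ y, ‖u τ y‖ ≤ M) (hvM : ∀ τ ∈ Ioo s T, ∀ y, ‖v τ y‖ ≤ M)
    {t t' : ℝ} (hst : s ≤ t) (htt' : t ≤ t') (hst' : s < t') (ht'T : t' ≤ T) (x : E) :
    oseenDuhamel ν s u v t' x =
      oseenDuhamel ν s ((Iio t).indicator u) ((Iio t).indicator v) t' x + oseenDuhamel ν t u v t' x := by
  set f : ℝ → E := fun τ => ∫ y, oseenKernel (ν * (t' - τ)) (x - y) (u τ y) (v τ y) with hf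
  -- integrability of the marginal on `(s, t')`
  have hint := integrable_oseenKernel_duhamel_bounded hν hu hv hM huM hvM hst' ht'T x
  rw [volume_restrict_prod_univ_eq_prod] at hint
  have hfi : IntegrableOn f (Ioo s t') := hint.integral_prod_left
  have hfi1 : IntegrableOn f (Ioc s t) :=
    (integrableOn_Ioc_iff_integrableOn_Ioo' (by simp)).2 (hfi.mono_set (Ioo_subset_Ioo_right htt'))
  have hfi2 : IntegrableOn f (Ioc t t') :=
    (integrableOn_Ioc_iff_integrableOn_Ioo' (by simp)).2 (hfi.mono_set (Ioo_subset_Ioo_left hst))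
  rw [oseenDuhamel_indicator_Iio htt' x, oseenDuhamel_apply, oseenDuhamel_apply]
  change ∫ τ in Ioo s t', f τ = (∫ τ in Ioo s t, f τ) + ∫ τ in Ioo t t', f τ
  rw [← integral_Ioc_eq_integral_Ioo, ← integral_Ioc_eq_integral_Ioo (f := f) (x := s),
    ← integral_Ioc_eq_integral_Ioo (f := f) (x := t), ← Ioc_union_Ioc_eq_Ioc hst htt',
    setIntegral_union (Ioc_disjoint_Ioc.2 (by simp)) measurableSet_Ioc hfi1 hfi2]

/-- Truncated bounded measurable fields are bounded measurable. [folklore] -/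
theorem aestronglyMeasurable_uncurry_indicator_Iio' (t : ℝ)
    (hu : AEStronglyMeasurable (uncurry u) ((volume : Measure (ℝ × E)).restrict (Ioo s T ×ˢ univ))) :
    AEStronglyMeasurable (uncurry ((Iio t).indicator u))
      ((volume : Measure (ℝ × E)).restrict (Ioo s T ×ˢ univ)) := by
  have heq : uncurry ((Iio t).indicator u) = (Iio t ×ˢ (univ : Set E)).indicator (uncurry u) := by
    funext ⟨τ, y⟩
    simp only [uncurry_apply_pair]
    by_cases h : τ < t
    · rw [indicator_Iio_apply_of_lt h, indicator_of_mem (show (τ, y) ∈ Iio t ×ˢ (univ : Set E) from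
        ⟨h, mem_univ _⟩)]
      rfl
    · rw [indicator_Iio_apply_of_le (not_lt.1 h),
        indicator_of_notMem (show (τ, y) ∉ Iio t ×ˢ (univ : Set E) from fun h' => h h'.1)]
  rw [heq]
  exact hu.indicator (measurableSet_Iio.prod MeasurableSet.univ)

omit [InnerProductSpace ℝ E] [MeasurableSpace E] [BorelSpace E] [FiniteDimensional ℝ E] in
/-- Truncation does not increase pointwise bounds. [folklore] -/
theorem norm_indicator_Iio_le {t : ℝ} (hbu : ∀ τ ∈ Ioo s T, ∀ y, ‖u τ y‖ ≤ M) (hM : 0 ≤ M)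
    (τ : ℝ) (hτ : τ ∈ Ioo s T) (y : E) : ‖(Iio t).indicator u τ y‖ ≤ M := by
  by_cases h : τ < t
  · rw [indicator_Iio_apply_of_lt h]; exact hbu τ hτ y
  · rw [indicator_Iio_apply_of_le (not_lt.1 h), norm_zero]; exact hM

end Split

/-! ### The increment against test fields -/

section Increment

variable {ν s T M N : ℝ} {u v : ℝ → E → E}

/-- A bounded a.e.-strongly-measurable field pairs integrably with a continuous compactly
supported field. [folklore] -/
theorem integrable_inner_test_of_norm_le {A φ : E → E} {C : ℝ} (hA : AEStronglyMeasurable A volume)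
    (hC : ∀ x, ‖A x‖ ≤ C) (hφ : Continuous φ) (hφc : HasCompactSupport φ) :
    Integrable (fun x => ⟪A x, φ x⟫) := by
  have hwi : Integrable (fun x => C * ‖φ x‖) :=
    ((hφ.norm).integrable_of_hasCompactSupport hφc.norm).const_mul C
  refine hwi.mono' (hA.inner hφ.aestronglyMeasurable) (Eventually.of_forall fun x => ?_)
  rw [Real.norm_eq_abs]
  calc |⟪A x, φ x⟫| ≤ ‖A x‖ * ‖φ x‖ := abs_real_inner_le_norm _ _
    _ ≤ C * ‖φ x‖ := by gcongr; exact hC x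

/-- The tested kernel `x ↦ ⟪K(σ, x - y)[a, b], φ(x)⟫` is integrable for `σ > 0` and a continuous
compactly supported `φ` (the kernel is continuous in `z`, `continuous_oseenKernel`). [folklore] -/
theorem integrable_inner_oseenKernel_sub_test {σ : ℝ} (hσ : 0 < σ) (y a b : E) {φ : E → E}
    (hφ : Continuous φ) (hφc : HasCompactSupport φ) :
    Integrable (fun x => ⟪oseenKernel σ (x - y) a b, φ x⟫) := by
  have hc : Continuous fun x => ⟪oseenKernel σ (x - y) a b, φ x⟫ :=
    ((continuous_oseenKernel hσ a b).comp (continuous_sub_right y)).inner hφ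
  refine hc.integrable_of_hasCompactSupport ?_
  refine HasCompactSupport.intro hφc fun x hx => ?_
  rw [image_eq_zero_of_notMem_tsupport hx, inner_zero_right]

/-- **The increment of the Duhamel term against a test field.** For bounded measurable fields on
`(s, T) × E`, `ν > 0`, `s < t ≤ t' ≤ T` and a continuous compactly supported `φ`,
`∫ ⟪B^ν_s(1_{<t}u, 1_{<t}v)(t') - B^ν_s(u, v)(t), φ⟫
  = ∫_{(s,t)×E} ∫_x ⟪(K(ν(t'-τ)) - K(ν(t-τ)))(x-y)[u(τ,y), v(τ,y)], φ(x)⟫ dx d(τ,y)`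
(the two Fubini identities `integral_inner_oseenDuhamel_eq_setIntegral`; the truncated integrand
vanishes for `τ ≥ t`). [folklore] -/
theorem integral_inner_oseenDuhamel_increment_eq (hν : 0 < ν)
    (hu : AEStronglyMeasurable (uncurry u) ((volume : Measure (ℝ × E)).restrict (Ioo s T ×ˢ univ)))
    (hv : AEStronglyMeasurable (uncurry v) ((volume : Measure (ℝ × E)).restrict (Ioo s T ×ˢ univ)))
    (hM : 0 ≤ M) (huM : ∀ τ ∈ Ioo s T, ∀ y, ‖u τ y‖ ≤ M) (hvM : ∀ τ ∈ Ioo s T, ∀ y, ‖v τ y‖ ≤ M)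
    {t t' : ℝ} (hst : s < t) (htt' : t ≤ t') (ht'T : t' ≤ T) {φ : E → E} (hφ : Continuous φ)
    (hφc : HasCompactSupport φ) :
    ∫ x, ⟪oseenDuhamel ν s ((Iio t).indicator u) ((Iio t).indicator v) t' x -
        oseenDuhamel ν s u v t x, φ x⟫ =
      ∫ p in Ioo s t ×ˢ univ, (∫ x, ⟪oseenKernel (ν * (t' - p.1)) (x - p.2) (u p.1 p.2) (v p.1 p.2) -
          oseenKernel (ν * (t - p.1)) (x - p.2) (u p.1 p.2) (v p.1 p.2), φ x⟫)
        ∂(volume : Measure (ℝ × E)) := by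
  set ut : ℝ → E → E := (Iio t).indicator u with hut
  set vt : ℝ → E → E := (Iio t).indicator v with hvt
  have hutm := aestronglyMeasurable_uncurry_indicator_Iio' (s := s) (T := T) t hu
  have hvtm := aestronglyMeasurable_uncurry_indicator_Iio' (s := s) (T := T) t hv
  have hutM : ∀ τ ∈ Ioo s T, ∀ y, ‖ut τ y‖ ≤ M := fun τ hτ y => norm_indicator_Iio_le huM hM τ hτ y
  have hvtM : ∀ τ ∈ Ioo s T, ∀ y, ‖vt τ y‖ ≤ M := fun τ hτ y => norm_indicator_Iio_le hvM hM τ hτ y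
  have hst' : s < t' := hst.trans_le htt'
  have htT : t ≤ T := htt'.trans ht'T
  obtain ⟨I1, E1⟩ := integral_inner_oseenDuhamel_eq_setIntegral hν hutm hvtm hM hutM hvtM hst' ht'T hφ hφc
  obtain ⟨I2, E2⟩ := integral_inner_oseenDuhamel_eq_setIntegral hν hu hv hM huM hvM hst htT hφ hφc
  obtain ⟨Cs, -, hsup⟩ := exists_norm_oseenDuhamel_bounded_le (E := E)
  -- the two pairings are integrable
  have hA : Integrable (fun x => ⟪oseenDuhamel ν s ut vt t' x, φ x⟫) :=
    integrable_inner_test_of_norm_le (aestronglyMeasurable_oseenDuhamel hν hutm hvtm hM hutM hvtM hst' ht'T)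
      (fun x => hsup hν hst' hM (fun τ hτ => hutM τ ⟨hτ.1, hτ.2.trans_le ht'T⟩)
        (fun τ hτ => hvtM τ ⟨hτ.1, hτ.2.trans_le ht'T⟩) x) hφ hφc
  have hB : Integrable (fun x => ⟪oseenDuhamel ν s u v t x, φ x⟫) :=
    integrable_inner_test_of_norm_le (aestronglyMeasurable_oseenDuhamel hν hu hv hM huM hvM hst htT)
      (fun x => hsup hν hst hM (fun τ hτ => huM τ ⟨hτ.1, hτ.2.trans_le htT⟩)
        (fun τ hτ => hvM τ ⟨hτ.1, hτ.2.trans_le htT⟩) x) hφ hφc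
  simp_rw [inner_sub_left]
  rw [integral_sub hA hB, E1, E2]
  -- the tested kernels
  set g' : ℝ × E → ℝ := fun p =>
    ∫ x, ⟪oseenKernel (ν * (t' - p.1)) (x - p.2) (u p.1 p.2) (v p.1 p.2), φ x⟫ with hg'
  set g : ℝ × E → ℝ := fun p =>
    ∫ x, ⟪oseenKernel (ν * (t - p.1)) (x - p.2) (u p.1 p.2) (v p.1 p.2), φ x⟫ with hg
  set gt : ℝ × E → ℝ := fun p =>
    ∫ x, ⟪oseenKernel (ν * (t' - p.1)) (x - p.2) (ut p.1 p.2) (vt p.1 p.2), φ x⟫ with hgt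
  -- the truncated tested kernel lives on `(s, t) × E`, where it is `g'`
  have hsub : Ioo s t ×ˢ (univ : Set E) ⊆ Ioo s t' ×ˢ univ := prod_mono (Ioo_subset_Ioo_right htt') subset_rfl
  have hE1 : ∫ p in Ioo s t' ×ˢ univ, gt p ∂(volume : Measure (ℝ × E)) =
      ∫ p in Ioo s t ×ˢ univ, g' p ∂(volume : Measure (ℝ × E)) := by
    rw [setIntegral_eq_of_subset_of_forall_sdiff_eq_zero (measurableSet_Ioo.prod MeasurableSet.univ)
      hsub (fun p hp => ?_)]
    · refine setIntegral_congr_fun (measurableSet_Ioo.prod MeasurableSet.univ) fun p hp => ?_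
      rw [mem_prod] at hp
      simp only [hgt, hg', hut, hvt, indicator_Iio_apply_of_lt hp.1.2]
    · have hp1 : t ≤ p.1 := by
        by_contra h
        exact hp.2 ⟨⟨hp.1.1.1, not_le.1 h⟩, mem_univ _⟩
      simp only [hgt, hut, indicator_Iio_apply_of_le hp1, oseenKernel_zero_left, inner_zero_left,
        integral_zero]
  rw [hE1]
  -- integrability of `g'` and `g` on `(s, t) × E`
  set μ : Measure (ℝ × E) := (volume : Measure (ℝ × E)).restrict (Ioo s t ×ˢ univ) with hμ
  have hg_int : Integrable g μ := I2.integral_prod_right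
  have hg'_int : Integrable g' μ := by
    have h1 : Integrable gt μ :=
      (I1.integral_prod_right).mono_measure (Measure.restrict_mono hsub le_rfl)
    refine h1.congr ?_
    filter_upwards [ae_restrict_mem (measurableSet_Ioo.prod MeasurableSet.univ)] with p hp
    rw [mem_prod] at hp
    simp only [hgt, hg', hut, hvt, indicator_Iio_apply_of_lt hp.1.2]
  rw [← integral_sub hg'_int hg_int]
  refine setIntegral_congr_fun (measurableSet_Ioo.prod MeasurableSet.univ) fun p hp => ?_
  rw [mem_prod] at hp
  have h1 : 0 < ν * (t' - p.1) := mul_pos hν (by linarith [hp.1.2])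
  have h2 : 0 < ν * (t - p.1) := mul_pos hν (sub_pos.2 hp.1.2)
  simp only [hg', hg]
  rw [← integral_sub (integrable_inner_oseenKernel_sub_test h1 _ _ _ hφ hφc)
    (integrable_inner_oseenKernel_sub_test h2 _ _ _ hφ hφc)]

/-- **The `L³` size of the increment from the kernel increment** (duality with the tested
estimate for the difference kernel `K(ν(t'-τ)) - K(ν(t-τ))`, majorised through an orthonormal
basis `e` by `m(τ, z) = ∑ᵢⱼ ‖K(ν(t'-τ),z)[eᵢ,eⱼ] - K(ν(t-τ),z)[eᵢ,eⱼ]‖`): with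
`Ω = ∫_{(s,t)} ∫ m`, finite, `‖B^ν_s(1_{<t}u,1_{<t}v)(t') - B^ν_s(u,v)(t)‖_{L³} ≤ M N Ω`. [folklore] -/
theorem eLpNorm_oseenDuhamel_increment_le (hν : 0 < ν)
    (hu : AEStronglyMeasurable (uncurry u) ((volume : Measure (ℝ × E)).restrict (Ioo s T ×ˢ univ)))
    (hv : AEStronglyMeasurable (uncurry v) ((volume : Measure (ℝ × E)).restrict (Ioo s T ×ˢ univ)))
    (hM : 0 ≤ M) (hN : 0 ≤ N) (huM : ∀ τ ∈ Ioo s T, ∀ y, ‖u τ y‖ ≤ M)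
    (hvM : ∀ τ ∈ Ioo s T, ∀ y, ‖v τ y‖ ≤ M) (hvm : ∀ τ ∈ Ioo s T, AEStronglyMeasurable (v τ) volume)
    (hv3 : ∀ τ ∈ Ioo s T, eLpNorm (v τ) 3 volume ≤ ENNReal.ofReal N)
    {t t' : ℝ} (hst : s < t) (htt' : t ≤ t') (ht'T : t' ≤ T)
    (hΩ : ∫⁻ τ in Ioo s t, ∫⁻ z, ENNReal.ofReal (∑ i, ∑ j,
        ‖oseenKernel (ν * (t' - τ)) z (stdOrthonormalBasis ℝ E i) (stdOrthonormalBasis ℝ E j) -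
          oseenKernel (ν * (t - τ)) z (stdOrthonormalBasis ℝ E i) (stdOrthonormalBasis ℝ E j)‖) < ⊤) :
    MemLp (fun x => oseenDuhamel ν s ((Iio t).indicator u) ((Iio t).indicator v) t' x -
        oseenDuhamel ν s u v t x) 3 volume ∧
      eLpNorm (fun x => oseenDuhamel ν s ((Iio t).indicator u) ((Iio t).indicator v) t' x -
        oseenDuhamel ν s u v t x) 3 volume ≤
        ENNReal.ofReal (M * N) * ∫⁻ τ in Ioo s t, ∫⁻ z, ENNReal.ofReal (∑ i, ∑ j,
          ‖oseenKernel (ν * (t' - τ)) z (stdOrthonormalBasis ℝ E i) (stdOrthonormalBasis ℝ E j) -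
            oseenKernel (ν * (t - τ)) z (stdOrthonormalBasis ℝ E i) (stdOrthonormalBasis ℝ E j)‖) := by
  set e := stdOrthonormalBasis ℝ E with he
  set m : ℝ → E → ℝ := fun τ z => ∑ i, ∑ j,
    ‖oseenKernel (ν * (t' - τ)) z (e i) (e j) - oseenKernel (ν * (t - τ)) z (e i) (e j)‖ with hm
  set Ω : ℝ≥0∞ := ∫⁻ τ in Ioo s t, ∫⁻ z, ENNReal.ofReal (m τ z) with hΩ_def
  change Ω < ⊤ at hΩ
  set ut : ℝ → E → E := (Iio t).indicator u with hut
  set vt : ℝ → E → E := (Iio t).indicator v with hvt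
  have hutm := aestronglyMeasurable_uncurry_indicator_Iio' (s := s) (T := T) t hu
  have hvtm := aestronglyMeasurable_uncurry_indicator_Iio' (s := s) (T := T) t hv
  have hutM : ∀ τ ∈ Ioo s T, ∀ y, ‖ut τ y‖ ≤ M := fun τ hτ y => norm_indicator_Iio_le huM hM τ hτ y
  have hvtM : ∀ τ ∈ Ioo s T, ∀ y, ‖vt τ y‖ ≤ M := fun τ hτ y => norm_indicator_Iio_le hvM hM τ hτ y
  have hst' : s < t' := hst.trans_le htt'
  have htT : t ≤ T := htt'.trans ht'T
  obtain ⟨Cs, -, hsup⟩ := exists_norm_oseenDuhamel_bounded_le (E := E)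
  set Q : E → E := fun x => oseenDuhamel ν s ut vt t' x - oseenDuhamel ν s u v t x with hQ
  -- the majorant of the difference kernel
  have hκ0 : ∀ τ ∈ Ioo s t, ∀ z, 0 ≤ m τ z := fun τ _ z =>
    Finset.sum_nonneg fun i _ => Finset.sum_nonneg fun j _ => norm_nonneg _
  have hκs : ∀ τ ∈ Ioo s t, ∀ z, m τ (-z) = m τ z := by
    intro τ _ z
    simp only [hm]
    refine Finset.sum_congr rfl fun i _ => Finset.sum_congr rfl fun j _ => ?_
    rw [oseenKernel_neg, oseenKernel_neg, ← neg_sub, norm_neg, neg_sub_neg, norm_sub_rev]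
  obtain ⟨C, -, hK⟩ := exists_lintegral_enorm_oseenKernel_le (E := E)
  have hκi : ∀ τ ∈ Ioo s t, Integrable (m τ) := by
    intro τ hτ
    have h1 : 0 < ν * (t' - τ) := mul_pos hν (by linarith [hτ.2])
    have h2 : 0 < ν * (t - τ) := mul_pos hν (sub_pos.2 hτ.2)
    refine integrable_finsetSum _ fun i _ => integrable_finsetSum _ fun j _ => ?_
    exact ((hK h1 (e i) (e j)).1.sub (hK h2 (e i) (e j)).1).norm
  have hκm : Measurable (uncurry m) := by
    refine Finset.measurable_sum _ fun i _ => Finset.measurable_sum _ fun j _ => ?_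
    refine Measurable.norm ?_
    refine (Measurable.oseenKernel_comp ?_ measurable_snd measurable_const measurable_const).sub
      (Measurable.oseenKernel_comp ?_ measurable_snd measurable_const measurable_const)
    · exact (measurable_const.sub measurable_fst).const_mul ν
    · exact (measurable_const.sub measurable_fst).const_mul ν
  have hG : ∀ τ ∈ Ioo s t, ∀ z p q, ‖oseenKernel (ν * (t' - τ)) z p q - oseenKernel (ν * (t - τ)) z p q‖ ≤
      m τ z * ‖p‖ * ‖q‖ := fun τ _ z p q => norm_oseenKernel_sub_le_sum_basis e _ _ z p q
  -- the tested bound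
  have htest : ∀ φ : E → E, FunctionSpaces.IsTestFunctionOn (⊤ : Opens E) φ →
      |∫ x, ⟪Q x, φ x⟫| ≤ M * N * Ω.toReal * (eLpNorm φ (3 / 2 : ℝ≥0∞) volume).toReal := by
    intro φ hφ
    have hφc := hφ.contDiff.continuous
    have hφs := hφ.hasCompactSupport
    have heq := integral_inner_oseenDuhamel_increment_eq hν hu hv hM huM hvM hst htt' ht'T hφc hφs
    have h := enorm_setIntegral_integral_inner_le_of_majorant
      (G := fun τ z p q => oseenKernel (ν * (t' - τ)) z p q - oseenKernel (ν * (t - τ)) z p q)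
      hκ0 hκi hκs hκm hG hM (fun τ hτ => huM τ ⟨hτ.1, hτ.2.trans_le htT⟩)
      (fun τ hτ => hvm τ ⟨hτ.1, hτ.2.trans_le htT⟩)
      (fun τ hτ => hv3 τ ⟨hτ.1, hτ.2.trans_le htT⟩) hφc hφs
    have hφ32 : eLpNorm φ (3 / 2) volume < ⊤ := (hφc.memLp_of_hasCompactSupport (p := 3 / 2) hφs).2
    have hfin : ENNReal.ofReal (M * N) * Ω * eLpNorm φ (3 / 2) volume ≠ ⊤ :=
      ENNReal.mul_ne_top (ENNReal.mul_ne_top ENNReal.ofReal_ne_top hΩ.ne) hφ32.ne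
    rw [hQ]
    simp only []
    rw [heq, ← Real.norm_eq_abs]
    calc ‖∫ p in Ioo s t ×ˢ univ, (∫ x, ⟪oseenKernel (ν * (t' - p.1)) (x - p.2) (u p.1 p.2) (v p.1 p.2) -
            oseenKernel (ν * (t - p.1)) (x - p.2) (u p.1 p.2) (v p.1 p.2), φ x⟫) ∂(volume : Measure (ℝ × E))‖
        = (‖∫ p in Ioo s t ×ˢ univ, (∫ x, ⟪oseenKernel (ν * (t' - p.1)) (x - p.2) (u p.1 p.2) (v p.1 p.2) -
            oseenKernel (ν * (t - p.1)) (x - p.2) (u p.1 p.2) (v p.1 p.2), φ x⟫)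
            ∂(volume : Measure (ℝ × E))‖ₑ).toReal := by simp
      _ ≤ (ENNReal.ofReal (M * N) * Ω * eLpNorm φ (3 / 2) volume).toReal := ENNReal.toReal_mono hfin h
      _ = M * N * Ω.toReal * (eLpNorm φ (3 / 2 : ℝ≥0∞) volume).toReal := by
          rw [ENNReal.toReal_mul, ENNReal.toReal_mul, ENNReal.toReal_ofReal (by positivity)]
  -- measurability and boundedness of `Q`
  have hQm : AEStronglyMeasurable Q volume :=
    (aestronglyMeasurable_oseenDuhamel hν hutm hvtm hM hutM hvtM hst' ht'T).sub
      (aestronglyMeasurable_oseenDuhamel hν hu hv hM huM hvM hst htT)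
  set Mb : ℝ := Cs * M ^ 2 * ν ^ (-(1 / 2 : ℝ)) * (2 * Real.sqrt (t' - s)) +
    Cs * M ^ 2 * ν ^ (-(1 / 2 : ℝ)) * (2 * Real.sqrt (t - s)) with hMb
  have hQb : ∀ x, ‖Q x‖ ≤ Mb := fun x =>
    (norm_sub_le _ _).trans (add_le_add
      (hsup hν hst' hM (fun τ hτ => hutM τ ⟨hτ.1, hτ.2.trans_le ht'T⟩)
        (fun τ hτ => hvtM τ ⟨hτ.1, hτ.2.trans_le ht'T⟩) x)
      (hsup hν hst hM (fun τ hτ => huM τ ⟨hτ.1, hτ.2.trans_le htT⟩)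
        (fun τ hτ => hvM τ ⟨hτ.1, hτ.2.trans_le htT⟩) x))
  have hQ2 : LocallyIntegrable (fun x => ‖Q x‖ ^ 2) volume := by
    have hmem : MemLp (fun x => ‖Q x‖ ^ 2) ∞ volume :=
      memLp_top_of_bound (hQm.norm.pow 2) (Mb ^ 2) (Eventually.of_forall fun x => by
        rw [Real.norm_eq_abs, abs_of_nonneg (by positivity)]
        exact pow_le_pow_left₀ (norm_nonneg _) (hQb x) 2)
    exact hmem.locallyIntegrable le_top
  have hmain := FunctionSpaces.memLp_three_of_forall_abs_integral_inner_le hQm hQ2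
    (by positivity : 0 ≤ M * N * Ω.toReal) htest
  refine ⟨hmain.1, hmain.2.trans (le_of_eq ?_)⟩
  rw [ENNReal.ofReal_mul (by positivity : 0 ≤ M * N), ENNReal.ofReal_toReal hΩ.ne]

end Increment

/-! ### Continuity in `L³` -/

section Continuity

variable {ν s T M N : ℝ} {u v : ℝ → E → E}

/-- The Duhamel term from time `s` vanishes at times `t ≤ s` (empty time interval). [folklore] -/
theorem oseenDuhamel_eq_zero_of_le {t : ℝ} (h : t ≤ s) (x : E) : oseenDuhamel ν s u v t x = 0 := by
  rw [oseenDuhamel_apply, Ioo_eq_empty (not_lt.2 h), Measure.restrict_empty, integral_zero_measure]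

/-- Reflection of a set `∫⁻` on `(s, t)`: `∫_{(s,t)} F(t - τ) dτ = ∫_{(0, t-s)} F(σ) dσ`. [folklore] -/
theorem setLIntegral_Ioo_reflect_sub (s t : ℝ) (F : ℝ → ℝ≥0∞) :
    ∫⁻ τ in Ioo s t, F (t - τ) = ∫⁻ σ in Ioo 0 (t - s), F σ := by
  have hmp : MeasurePreserving (fun τ : ℝ => t - τ) volume volume :=
    Measure.measurePreserving_sub_left volume t
  have hemb : MeasurableEmbedding (fun τ : ℝ => t - τ) :=
    (MeasurableEquiv.subLeft t).measurableEmbedding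
  have h := hmp.setLIntegral_comp_preimage_emb hemb F (Ioo 0 (t - s))
  rw [preimage_const_sub_Ioo, sub_zero, sub_sub_cancel] at h
  exact h

/-- **The Duhamel term of bounded fields is continuous in time with values in `L³`**
(Lemarié-Rieusset 2016, proof of Thm. 7.5, PDF pp. 157–158: continuity of `H = B(F,G)` at
`t > 0` through `W_{ν(t-s)} - W_{ν(θ-s)} = ∫_t^θ νΔW_{ν(τ-s)} dτ`; here for one factor in `L^∞`).
For `ν > 0`, fields `u`, `v` measurable on `(s, T) × E` and bounded by `M` there, `v` with
measurable slices and `‖v(τ)‖_{L³} ≤ N`: `t ↦ B^ν_s(u,v)(t)` lies in `C([s, T]; L³)`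
(`Fluid.ContinuousInLpOn (Icc s T) 3`). Proof: for `s ≤ t ≤ t' ≤ T`,
`B(t') - B(t) = B^ν_t(u,v)(t') + [B^ν_s(1_{<t}u,1_{<t}v)(t') - B^ν_s(u,v)(t)]`
(`oseenDuhamel_eq_indicator_add`); the first term has `‖·‖_{L³} ≤ C M N ν^{-1/2} √(t'-t)`
(`exists_eLpNorm_oseenDuhamel_three_le` from the initial time `t`), the second
`≤ M N ∫_{(0,t-s)} ∫ ∑ᵢⱼ ‖K(ν(σ + (t'-t))) - K(νσ)‖ ≤ M N Ω_{T-s}(t'-t)`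
(`eLpNorm_oseenDuhamel_increment_le`), and `Ω_S(h) → 0` as `h → 0⁺`
(`tendsto_lintegral_sum_norm_oseenKernel_sub`): a modulus of continuity uniform in `t`. [cite: LemarieRieusset2016, Thm. 7.5 (proof, PDF pp. 157–158)] -/
theorem continuousInLpOn_oseenDuhamel_three (hν : 0 < ν)
    (hu : AEStronglyMeasurable (uncurry u) ((volume : Measure (ℝ × E)).restrict (Ioo s T ×ˢ univ)))
    (hv : AEStronglyMeasurable (uncurry v) ((volume : Measure (ℝ × E)).restrict (Ioo s T ×ˢ univ)))
    (hM : 0 ≤ M) (hN : 0 ≤ N) (huM : ∀ τ ∈ Ioo s T, ∀ y, ‖u τ y‖ ≤ M)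
    (hvM : ∀ τ ∈ Ioo s T, ∀ y, ‖v τ y‖ ≤ M) (hvm : ∀ τ ∈ Ioo s T, AEStronglyMeasurable (v τ) volume)
    (hv3 : ∀ τ ∈ Ioo s T, eLpNorm (v τ) 3 volume ≤ ENNReal.ofReal N) :
    ContinuousInLpOn (Icc s T) 3 (oseenDuhamel ν s u v) := by
  set B := oseenDuhamel ν s u v with hB
  obtain ⟨C3, hC3, hL3⟩ := exists_eLpNorm_oseenDuhamel_three_le (E := E)
  -- the degenerate case `T ≤ s`
  rcases le_or_gt T s with hTs | hsT
  · have hzero : ∀ t ∈ Icc s T, B t = 0 := fun t ht => funext fun x =>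
      oseenDuhamel_eq_zero_of_le (ht.2.trans hTs) x
    refine ⟨fun t ht => by rw [hzero t ht]; exact MemLp.zero, fun t₀ ht₀ => ?_⟩
    refine (tendsto_congr' ?_).2 tendsto_const_nhds
    filter_upwards [self_mem_nhdsWithin] with t ht
    rw [hzero t ht, hzero t₀ ht₀, sub_zero, eLpNorm_zero]
  -- the `L³` bound from an intermediate initial time
  have hL3' : ∀ t t' : ℝ, s ≤ t → t < t' → t' ≤ T →
      MemLp (oseenDuhamel ν t u v t') 3 volume ∧ eLpNorm (oseenDuhamel ν t u v t') 3 volume ≤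
        ENNReal.ofReal (C3 * M * N * ν ^ (-(1 / 2 : ℝ)) * Real.sqrt (t' - t)) := by
    intro t t' hst htt' ht'T
    have hsub : Ioo t T ×ˢ (univ : Set E) ⊆ Ioo s T ×ˢ univ := prod_mono (Ioo_subset_Ioo_left hst) subset_rfl
    exact hL3 hν hM hN (hu.mono_measure (Measure.restrict_mono hsub le_rfl))
      (hv.mono_measure (Measure.restrict_mono hsub le_rfl))
      (fun τ hτ => huM τ ⟨hst.trans_lt hτ.1, hτ.2⟩) (fun τ hτ => hvM τ ⟨hst.trans_lt hτ.1, hτ.2⟩)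
      (fun τ hτ => hvm τ ⟨hst.trans_lt hτ.1, hτ.2⟩) htt' ht'T
      (fun τ hτ => hv3 τ ⟨hst.trans_lt hτ.1, hτ.2.trans_le ht'T⟩)
  -- the kernel increment functional `Ω_S`
  set e := stdOrthonormalBasis ℝ E with he
  set S : ℝ := T - s with hS
  have hS0 : 0 < S := sub_pos.2 hsT
  set ΩS : ℝ → ℝ≥0∞ := fun h => ∫⁻ σ in Ioo 0 S, ∫⁻ z, ENNReal.ofReal
    (∑ i, ∑ j, ‖oseenKernel (ν * (σ + h)) z (e i) (e j) - oseenKernel (ν * σ) z (e i) (e j)‖) with hΩS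
  have hΩ0 : ΩS 0 = 0 := by simp [hΩS]
  have hΩlim : Tendsto ΩS (𝓝[>] 0) (𝓝 0) := tendsto_lintegral_sum_norm_oseenKernel_sub hν hS0
  have hΩlim' : Tendsto ΩS (𝓝[≥] 0) (𝓝 0) := by
    rw [← Ioi_insert, nhdsWithin_insert, tendsto_sup]
    exact ⟨by simpa [hΩ0] using tendsto_pure_nhds ΩS 0, hΩlim⟩
  -- the modulus
  set ρ : ℝ → ℝ≥0∞ := fun h => ENNReal.ofReal (C3 * M * N * ν ^ (-(1 / 2 : ℝ)) * Real.sqrt h) +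
    ENNReal.ofReal (M * N) * ΩS h with hρ
  have hρlim : Tendsto ρ (𝓝[≥] 0) (𝓝 0) := by
    have h1 : Tendsto (fun h : ℝ => ENNReal.ofReal (C3 * M * N * ν ^ (-(1 / 2 : ℝ)) * Real.sqrt h))
        (𝓝[≥] 0) (𝓝 0) := by
      have hc : Continuous fun h : ℝ => ENNReal.ofReal (C3 * M * N * ν ^ (-(1 / 2 : ℝ)) * Real.sqrt h) :=
        ENNReal.continuous_ofReal.comp (continuous_const.mul Real.continuous_sqrt)
      have h := hc.tendsto 0
      simp only [Real.sqrt_zero, mul_zero, ENNReal.ofReal_zero] at h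
      exact h.mono_left nhdsWithin_le_nhds
    have h2 : Tendsto (fun h : ℝ => ENNReal.ofReal (M * N) * ΩS h) (𝓝[≥] 0) (𝓝 0) := by
      have h := ENNReal.Tendsto.const_mul (a := ENNReal.ofReal (M * N)) hΩlim'
        (Or.inr ENNReal.ofReal_ne_top)
      rwa [mul_zero] at h
    simp only [hρ]
    simpa using h1.add h2
  have hΩfin : ∀ᶠ h in 𝓝[≥] (0 : ℝ), ΩS h < ⊤ :=
    (hΩlim'.eventually (gt_mem_nhds (zero_lt_one : (0 : ℝ≥0∞) < 1))).mono fun h hh =>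
      hh.trans ENNReal.one_lt_top
  -- ### the key estimate: `‖B(t') - B(t)‖₃ ≤ ρ(t' - t)`
  have key : ∀ t t' : ℝ, t ∈ Icc s T → t' ∈ Icc s T → t ≤ t' → ΩS (t' - t) < ⊤ →
      eLpNorm (B t' - B t) 3 volume ≤ ρ (t' - t) := by
    intro t t' ht ht' htt' hfin
    rcases htt'.eq_or_lt with h | htt'_lt
    · subst h; simp
    rcases ht.1.eq_or_lt with h | hst
    · -- `t = s`: `B t = 0`
      have hz : B t = 0 := funext fun x => oseenDuhamel_eq_zero_of_le h.symm.le x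
      rw [hz, sub_zero, ← h]
      simp only [hρ]
      exact ((hL3' s t' le_rfl (h.symm ▸ htt'_lt) ht'.2).2).trans le_self_add
    -- `s < t`: split at `t`
    set ut : ℝ → E → E := (Iio t).indicator u with hut
    set vt : ℝ → E → E := (Iio t).indicator v with hvt
    set Q : E → E := fun x => oseenDuhamel ν s ut vt t' x - oseenDuhamel ν s u v t x with hQ
    have hdec : B t' - B t = (fun x => oseenDuhamel ν t u v t' x) + Q := by
      funext x
      simp only [hB, Pi.sub_apply, Pi.add_apply, hQ]
      rw [oseenDuhamel_eq_indicator_add hν hu hv hM huM hvM hst.le htt' (hst.trans htt'_lt) ht'.2 x]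
      abel
    -- the increment functional on `(s, t)` is at most `Ω_S(t' - t)`
    set Ωst : ℝ≥0∞ := ∫⁻ τ in Ioo s t, ∫⁻ z, ENNReal.ofReal (∑ i, ∑ j,
        ‖oseenKernel (ν * (t' - τ)) z (e i) (e j) - oseenKernel (ν * (t - τ)) z (e i) (e j)‖) with hΩst
    have hΩle : Ωst ≤ ΩS (t' - t) := by
      have heq : Ωst = ∫⁻ σ in Ioo 0 (t - s), ∫⁻ z, ENNReal.ofReal (∑ i, ∑ j,
          ‖oseenKernel (ν * (σ + (t' - t))) z (e i) (e j) - oseenKernel (ν * σ) z (e i) (e j)‖) := by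
        rw [hΩst, ← setLIntegral_Ioo_reflect_sub s t (fun σ => ∫⁻ z, ENNReal.ofReal (∑ i, ∑ j,
          ‖oseenKernel (ν * (σ + (t' - t))) z (e i) (e j) - oseenKernel (ν * σ) z (e i) (e j)‖))]
        refine setLIntegral_congr_fun measurableSet_Ioo fun τ _ => ?_
        simp only [show t - τ + (t' - t) = t' - τ by ring]
      rw [heq]
      exact lintegral_mono_set (Ioo_subset_Ioo_right (by linarith [ht.2]))
    have hQest := eLpNorm_oseenDuhamel_increment_le hν hu hv hM hN huM hvM hvm hv3 hst htt' ht'.2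
      (hΩle.trans_lt hfin)
    have hPest := hL3' t t' hst.le htt'_lt ht'.2
    rw [hdec]
    calc eLpNorm ((fun x => oseenDuhamel ν t u v t' x) + Q) 3 volume
        ≤ eLpNorm (fun x => oseenDuhamel ν t u v t' x) 3 volume + eLpNorm Q 3 volume :=
          eLpNorm_add_le hPest.1.1 hQest.1.1 (by norm_num)
      _ ≤ ENNReal.ofReal (C3 * M * N * ν ^ (-(1 / 2 : ℝ)) * Real.sqrt (t' - t)) +
            ENNReal.ofReal (M * N) * Ωst := add_le_add hPest.2 hQest.2
      _ ≤ ρ (t' - t) := by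
          simp only [hρ]
          gcongr
  -- ### assembling the continuity
  refine ⟨fun t ht => ?_, fun t₀ ht₀ => ?_⟩
  · rcases ht.1.eq_or_lt with h | hst
    · have hz : B t = 0 := funext fun x => oseenDuhamel_eq_zero_of_le h.symm.le x
      rw [hz]; exact MemLp.zero
    · exact (hL3' s t le_rfl hst ht.2).1
  · have hdist : Tendsto (fun t : ℝ => |t - t₀|) (𝓝[Icc s T] t₀) (𝓝[≥] 0) := by
      refine tendsto_nhdsWithin_iff.2 ⟨?_, Eventually.of_forall fun t => mem_Ici.2 (abs_nonneg _)⟩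
      have h := ((continuous_sub_right t₀).abs.tendsto t₀).mono_left (nhdsWithin_le_nhds (s := Icc s T))
      simpa using h
    have hup : Tendsto (fun t => ρ |t - t₀|) (𝓝[Icc s T] t₀) (𝓝 0) := hρlim.comp hdist
    have hfinev : ∀ᶠ t in 𝓝[Icc s T] t₀, ΩS |t - t₀| < ⊤ := hdist.eventually hΩfin
    have hle : ∀ᶠ t in 𝓝[Icc s T] t₀, eLpNorm (B t - B t₀) 3 volume ≤ ρ |t - t₀| := by
      filter_upwards [hfinev, self_mem_nhdsWithin] with t hfin ht
      rcases le_total t t₀ with h | h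
      · rw [abs_of_nonpos (sub_nonpos.2 h), neg_sub] at hfin ⊢
        rw [← neg_sub, eLpNorm_neg]
        exact key t t₀ ht ht₀ h hfin
      · rw [abs_of_nonneg (sub_nonneg.2 h)] at hfin ⊢
        exact key t₀ t ht₀ ht h hfin
    exact tendsto_of_tendsto_of_tendsto_of_le_of_le' tendsto_const_nhds hup
      (Eventually.of_forall fun _ => zero_le) hle

end Continuity

end Literature.Analysis.FluidPDE

end
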